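/-
Copyright (c) 2026. Released under Apache 2.0 license.
-/
import Literature.NumberTheory.Automorphic.UnboundedDenominatorsTwoLayer
import HarnessLib

/-!
# The invariant form of CDT Cor. 4.5.3 at level `4m`: the commutators `[T, h]`, `[S, h]` for `h ≡ -1 (mod 4)`

At level `N = 4m` (`m` odd) the top layer `Γ(2m)/Γ(4m) ≅ 𝔰𝔩₂(𝔽₂)` contains the class of `-1` (the class
`H`).  For an `SL₂(ℤ)`-conjugation-invariant `θ : Γ(4m) → Q` of `2`-power exponent and any `h ∈ Γ(2m)` with
`h ≡ -1 (mod 4)`, **`θ([T, h]) = θ([S, h]) = 1`** (`map_commutator_eq_one_of_neg_one_mod_four`): `g ↦ θ([g, h])`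
is a character of `SL₂(ℤ)` (invariance), it kills a lift `s₁ ∈ Γ(m)` of `S mod 4` (as `h ≡ s₁²`) and the
`Γ(4)`-correction `S⁻¹s₁` (cross-commutators `[Γ(4), Γ(m)]` die), hence `S`; and the modular relation
`(ST)³ = S²` forces `χ(T)³ = 1`, so `χ(T) = 1` (`2`-power order).  This is why Beyl's `ℤ/2` at level `4m` is
carried by `ω₀ = [T^{2m}, S T^{2m} S⁻¹]` and not by `[T, h]` ([Beyl1986]).
[cite: CalegariDimitrovTang2025, Corollary 4.5.3] [cite: Beyl1986, Theorem]
-/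

open scoped MatrixGroups commutatorElement

namespace Literature.NumberTheory.Automorphic

namespace UnboundedDenominators

open CongruenceSubgroup Matrix.SpecialLinearGroup ModularGroup

variable {Q : Type*} [CommGroup Q]

/-- `Γ(L) ≤ Γ(M)` for `M ∣ L`. [folklore] -/
private theorem Gamma_le_Gamma_of_dvd₁₄ {M L : ℕ} (h : M ∣ L) : Gamma L ≤ Gamma M := by
  intro γ hγ
  obtain ⟨h00, h01, h10, h11⟩ := Gamma_mem.mp hγ
  have cast_eq : ∀ a : ℤ, ((a : ZMod L).cast : ZMod M) = (a : ZMod M) := fun a ↦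
    ZMod.cast_intCast h a
  rw [Gamma_mem]
  refine ⟨?_, ?_, ?_, ?_⟩
  · rw [← cast_eq, h00, ZMod.cast_one h]
  · rw [← cast_eq, h01, ZMod.cast_zero]
  · rw [← cast_eq, h10, ZMod.cast_zero]
  · rw [← cast_eq, h11, ZMod.cast_one h]

/-- `S² = -1` is central in `SL₂(ℤ)`. [folklore] -/
private theorem S_mul_S_comm₃ (g : SL(2, ℤ)) : S * S * g = g * (S * S) := by
  have hS2 : (S : Matrix (Fin 2) (Fin 2) ℤ) * (S : Matrix (Fin 2) (Fin 2) ℤ) = -1 := by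
    rw [coe_S]
    ext i j
    fin_cases i <;> fin_cases j <;> simp [Matrix.mul_apply, Fin.sum_univ_two]
  apply Subtype.ext
  simp only [Matrix.SpecialLinearGroup.coe_mul]
  rw [hS2, neg_one_mul, mul_neg_one]

/-- The modular relation `(ST)³ = S²` in `SL₂(ℤ)`. [folklore] -/
private theorem S_T_cubed : (S * T) ^ 3 = S * S := by
  apply Subtype.ext
  simp only [Matrix.SpecialLinearGroup.coe_pow, Matrix.SpecialLinearGroup.coe_mul, coe_S, coe_T]
  ext i j
  fin_cases i <;> fin_cases j <;> simp [pow_succ, Matrix.mul_apply, Fin.sum_univ_two]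

/-- `S⁴ = 1` in `SL₂(ℤ)`. [folklore] -/
private theorem S_pow_four : S * S * (S * S) = (1 : SL(2, ℤ)) := by
  apply Subtype.ext
  simp only [Matrix.SpecialLinearGroup.coe_mul, Matrix.SpecialLinearGroup.coe_one, coe_S]
  ext i j
  fin_cases i <;> fin_cases j <;> simp [Matrix.mul_apply, Fin.sum_univ_two]

/-- **At level `4m` (`m` odd), `θ([T, h]) = θ([S, h]) = 1` for every `h ∈ Γ(2m)` with `h ≡ -1 (mod 4)`** and
every `SL₂(ℤ)`-conjugation-invariant `θ : Γ(4m) → Q` of `2`-power exponent.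
[cite: CalegariDimitrovTang2025, Corollary 4.5.3] [cite: Beyl1986, Theorem] -/
theorem map_commutator_eq_one_of_neg_one_mod_four {m a : ℕ} (hm : Odd m) (θ : Gamma (4 * m) →* Q)
    (hθ : ∀ (g x : SL(2, ℤ)) (hx : x ∈ Gamma (4 * m)) (hgx : g * x * g⁻¹ ∈ Gamma (4 * m)),
      θ ⟨g * x * g⁻¹, hgx⟩ = θ ⟨x, hx⟩)
    (he : ∀ x : Gamma (4 * m), θ x ^ (2 ^ a) = 1) {h : SL(2, ℤ)} (hh : h ∈ Gamma (2 * m))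
    (hh4 : S * S * h ∈ Gamma 4) (g : SL(2, ℤ)) (hg : g = T ∨ g = S) (hgh : ⁅g, h⁆ ∈ Gamma (4 * m)) :
    θ ⟨⁅g, h⁆, hgh⟩ = 1 := by
  classical
  haveI := Gamma_normal (4 * m)
  haveI := Gamma_normal (2 * m)
  haveI := Gamma_normal m
  haveI := Gamma_normal 4
  haveI : NeZero m := ⟨fun h0 ↦ by simp [h0] at hm⟩
  have hm2 : Nat.Coprime 2 m := Nat.coprime_two_left.mpr hm
  have h4m : Nat.Coprime 4 m := by
    rw [show (4 : ℕ) = 2 ^ 2 by norm_num]; exact Nat.Coprime.pow_left 2 hm2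
  have hhm : h ∈ Gamma m := Gamma_le_Gamma_of_dvd₁₄ (dvd_mul_left m 2) hh
  -- every commutator `[g, h]` lies in `Γ(4m)`
  have hcomm4 : ∀ x : SL(2, ℤ), ⁅x, S * S * h⁆ = ⁅x, h⁆ := by
    intro x
    simp only [commutatorElement_def]
    calc x * (S * S * h) * x⁻¹ * (S * S * h)⁻¹ = x * (S * S) * h * x⁻¹ * h⁻¹ * (S * S)⁻¹ := by group
      _ = S * S * (x * h * x⁻¹ * h⁻¹) * (S * S)⁻¹ := by rw [← S_mul_S_comm₃ x]; group
      _ = x * h * x⁻¹ * h⁻¹ := by rw [S_mul_S_comm₃ (x * h * x⁻¹ * h⁻¹), mul_inv_cancel_right]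
  have hmemN : ∀ x : SL(2, ℤ), ⁅x, h⁆ ∈ Gamma (4 * m) := by
    intro x
    refine mem_Gamma_mul_of_coprime h4m ?_ ?_
    · rw [← hcomm4 x, commutatorElement_def]
      exact mul_mem ((Gamma_normal 4).conj_mem _ hh4 x) (inv_mem hh4)
    · rw [commutatorElement_def]
      exact mul_mem ((Gamma_normal m).conj_mem _ hhm x) (inv_mem hhm)
  -- the character `χ(x) = θ([x, h])`
  have hmul : ∀ x y : SL(2, ℤ), θ ⟨⁅x * y, h⁆, hmemN (x * y)⟩ = θ ⟨⁅x, h⁆, hmemN x⟩ * θ ⟨⁅y, h⁆, hmemN y⟩ := by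
    intro x y
    have hc : x * ⁅y, h⁆ * x⁻¹ ∈ Gamma (4 * m) := (Gamma_normal _).conj_mem _ (hmemN y) x
    have h1 : (⟨⁅x * y, h⁆, hmemN (x * y)⟩ : Gamma (4 * m)) = ⟨x * ⁅y, h⁆ * x⁻¹, hc⟩ * ⟨⁅x, h⁆, hmemN x⟩ :=
      Subtype.ext (by simp only [Subgroup.coe_mul, commutatorElement_def]; group)
    rw [h1, map_mul, hθ x _ (hmemN y) hc, mul_comm]
  set χ : SL(2, ℤ) →* Q := MonoidHom.mk' (fun x ↦ θ ⟨⁅x, h⁆, hmemN x⟩) hmul with hχ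
  have hχapply : ∀ x, χ x = θ ⟨⁅x, h⁆, hmemN x⟩ := fun x ↦ rfl
  -- `χ` kills `Γ(4m)` and `Γ(4)`, and the lift `s₁` of `S mod 4` inside `Γ(m)`
  have hχN : ∀ γ ∈ Gamma (4 * m), χ γ = 1 := by
    intro γ hγ
    have hc : γ * h * γ⁻¹ * h⁻¹ ∈ Gamma (4 * m) := by rw [← commutatorElement_def]; exact hmemN γ
    rw [hχapply]
    -- `θ(γ · hγ⁻¹h⁻¹… )`: `[γ, h] = γ (h γ⁻¹ h⁻¹)`
    have hc2 : h * γ⁻¹ * h⁻¹ ∈ Gamma (4 * m) := (Gamma_normal _).conj_mem _ (inv_mem hγ) h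
    have h1 : (⟨⁅γ, h⁆, hmemN γ⟩ : Gamma (4 * m)) = ⟨γ, hγ⟩ * ⟨h * γ⁻¹ * h⁻¹, hc2⟩ :=
      Subtype.ext (by simp only [Subgroup.coe_mul, commutatorElement_def]; group)
    rw [h1, map_mul, hθ h _ (inv_mem hγ) hc2]
    have h2 : (⟨γ⁻¹, inv_mem hγ⟩ : Gamma (4 * m)) = ⟨γ, hγ⟩⁻¹ := rfl
    rw [h2, map_inv, mul_inv_cancel]
  have hχ4 : ∀ γ ∈ Gamma 4, χ γ = 1 := by
    intro γ hγ
    rw [hχapply]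
    have h1 : (⟨⁅γ, h⁆, hmemN γ⟩ : Gamma (4 * m)) =
        ⟨⁅γ, h⁆, commutatorElement_mem_Gamma_mul h4m hγ hhm⟩ := rfl
    rw [h1]
    exact map_commutatorElement_eq_one h4m θ hθ hγ hhm
  obtain ⟨s₁, hs₁m, hs₁⟩ := exists_mem_Gamma_map_eq (m := 4) h4m.symm
    (Matrix.SpecialLinearGroup.map (Int.castRingHom (ZMod 4)) S)
  have hγ4 : S⁻¹ * s₁ ∈ Gamma 4 := by
    rw [Gamma_mem', map_mul, map_inv, hs₁, inv_mul_cancel]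
  -- `h ≡ s₁² (mod Γ(4m))`
  have hhs : h * (s₁ * s₁)⁻¹ ∈ Gamma (4 * m) := by
    refine mem_Gamma_mul_of_coprime h4m ?_ (mul_mem hhm (inv_mem (mul_mem hs₁m hs₁m)))
    have e1 : h * (s₁ * s₁)⁻¹ = (S * S)⁻¹ * (S * S * h) * (s₁ * s₁)⁻¹ := by group
    have hred4 : Matrix.SpecialLinearGroup.map (Int.castRingHom (ZMod 4)) (S * S * h) = 1 :=
      Gamma_mem'.mp hh4
    rw [Gamma_mem', e1, map_mul, map_mul, hred4, mul_one, map_inv, map_inv, map_mul, map_mul, hs₁,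
      ← mul_inv_rev, ← map_mul, ← map_mul, S_pow_four, map_one, inv_one]
  have hχs₁ : χ s₁ = 1 := by
    rw [hχapply]
    set γ' := h * (s₁ * s₁)⁻¹ with hγ'
    have hγ'c : s₁ * γ' * s₁⁻¹ ∈ Gamma (4 * m) := (Gamma_normal _).conj_mem _ hhs s₁
    have h1 : ⁅s₁, h⁆ = s₁ * γ' * s₁⁻¹ * γ'⁻¹ := by rw [hγ', commutatorElement_def]; group
    have h2 : (⟨⁅s₁, h⁆, hmemN s₁⟩ : Gamma (4 * m)) = ⟨s₁ * γ' * s₁⁻¹, hγ'c⟩ * ⟨γ', hhs⟩⁻¹ :=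
      Subtype.ext h1
    rw [h2, map_mul, map_inv, hθ s₁ _ hhs hγ'c, mul_inv_cancel]
  have hχS : χ S = 1 := by
    have h1 : S = s₁ * (S⁻¹ * s₁)⁻¹ := by group
    rw [h1, map_mul, map_inv, hχs₁, hχ4 _ hγ4, inv_one, mul_one]
  have hχT : χ T = 1 := by
    have hrel := congrArg χ S_T_cubed
    rw [map_pow, map_mul, map_mul, hχS, one_mul, one_mul] at hrel
    have h2 : χ T ^ 2 ^ a = 1 := by rw [hχapply]; exact he _
    have cop : Nat.Coprime 3 (2 ^ a) :=
      Nat.Coprime.pow_right a ((Nat.coprime_primes Nat.prime_three Nat.prime_two).mpr (by decide))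
    have h3 := pow_gcd_eq_one.mpr ⟨hrel, h2⟩
    rwa [Nat.Coprime.gcd_eq_one cop, pow_one] at h3
  rcases hg with rfl | rfl
  · have : (⟨⁅T, h⁆, hgh⟩ : Gamma (4 * m)) = ⟨⁅T, h⁆, hmemN T⟩ := rfl
    rw [this, ← hχapply, hχT]
  · have : (⟨⁅S, h⁆, hgh⟩ : Gamma (4 * m)) = ⟨⁅S, h⁆, hmemN S⟩ := rfl
    rw [this, ← hχapply, hχS]

end UnboundedDenominators

end Literature.NumberTheory.Automorphic
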